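/-
Copyright (c) 2026 the pub-hodgecm-mathlib formalisation cell (harness21).  Prover seat hodgecm-mathlib-LH4-p18 (g0), req620 Track A «(D-RAM) FOUR-FRAME» squad, helper lane on
h413 = stmt-HodgeConjecture-24833 (count-neutral).  β-BOARD v1 (sub-dealer LH4-p05 (g8)) row R5 «G₃ ε-BOUNDARY», the `n₂`-CELL HALF (R5a) BY THE (0 1)-SWAP ENGINE.  2026-09-04.
-/
import Summits.HodgeConjecture.HodgeConjecture.Theorems.F0P3cDyRamLabelledOddSwapEngine          -- ★ (this seat): `finsum_stratum_shell_labelledOdd_div_relIndex_swap01_of`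
import Summits.HodgeConjecture.HodgeConjecture.Theorems.F0P3cDyRamLabelledOddPureStrataG3OfRecord  -- ★ (LH4-p11 (g9)): the G₃ `n₁`-cell column OF RECORD `finsum_stratum_G3_shell_labelledOdd_div_relIndex_eq_ofRecord` (★ p861290 ∘ ★ p861341 ∘ ★ p861330); brings ★ `vec3_swap01`, ★ `normSign_mul_of_dichotomy`, ★ the non-norm dichotomy
import Summits.HodgeConjecture.HodgeConjecture.Theorems.F0P3cDyRamElementDatumParity             -- ★ (LH4-p10 (g2)): `isoceles_of_isElementDatum`, `depth_mod_two_eq_of_isElementDatum`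
import HarnessLib

/-!
# Crux `H413`, line LH4 «(D-RAM) FOUR-FRAME» — (β-BAL) Stage B, β-BOARD ROW R5 «G₃ ε-BOUNDARY», THE `n₂`-CELL HALF (R5a) BY THE (0 1)-SWAP ENGINE:
# `Σᶠ_{M ∈ stratum G₃, clean shell} m^Λ_i(M) ∕ [𝒰 : N(S̃(M))]` in the cell `2ρ + m* ≤ n₂` — the G₃ stratum `(2ρ+s, 2ρ+s, 2ρ)` is `(0 1)`-symmetric, so the `n₂`-cell column is the
# ★ `n₁`-cell column of record (★ p861290 ∘ ★ p861341 ∘ ★ p861330) AT THE SWAPPED DATUM `(β, α; n₂, n₁, n₃)`, slots `0 ↔ 1`, token `e_C ↦ −e_C`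

Cell `hodgecm-mathlib` (D-0151), FLOOR 0, crux item H413 = `stmt-HodgeConjecture-24833`, route `HCCMUnconditional`; squad F0∕P3c∕LH4.  THEOREMS ONLY (no `def`, no instance, no
notation, no `sorry`, default heartbeats); ★-only imports; lane `--supports stmt-HodgeConjecture-24833 --as helper` (count-neutral); pays NO row, states NO law.

WHAT (β-BOARD v1 R5 split R5a∕R5b, LH4-p18 (g0) 15:28:35Z ∕ LH7-p06 (g0) 15:30:16Z; consumer = LH4-p10 (g6)'s ★ p861354 adapter `hG3t_of_cell_and_beyond`, BEYOND binder, assembled as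
`Nat.lt_or_ge` on `n₂` of THIS head and LH7-p06's R5b head).
* §1 **`finsum_stratum_G3_shell_labelledOdd_div_relIndex_eq_of_cell₂`** — the `n₂`-CELL COLUMN (`2ρ + m* ≤ n₂`, no condition on `n₁`): the `n₁`-cell column of record ★
  `finsum_stratum_G3_shell_labelledOdd_div_relIndex_eq_ofRecord` (LH4-p11 (g9): ★ p861290 ∘ ★ p861341 ∘ ★ p861330) at the swapped datum through ★
  `finsum_stratum_shell_labelledOdd_div_relIndex_swap01_of` (witness `w := −e_C`, a token of `α − β`), then `ω(−e_C) = ω(−1)·ω(e_C)` (★ `normSign_mul_of_dichotomy`):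
  `[2ρ+s+ℓ₀ = n₃ ∧ 2∣s ∧ 2ρ ≤ min n₁ n₂] · ω(e_C)∕2 · (ω(−1)·q^e·((q−1)[2d ≤ s] − [s+2 = 2d]), (q−1)·q^e, 0)_i`, `e = 2ρ + s∕2 − 1`.
* §2 **`finsum_stratum_G3_shell_labelledOdd_div_relIndex_beyond_of_cell₂`** — R5a IN THE BRACKET CURRENCY OF ★ (T1) p861261 `hG3t` ∕ (T2) `hP2G3` ∕ ★ p861354 `hbeyond`, on its domain
  `n₁ < 2ρ + m* ≤ n₂` (read `2ρ+s+ℓ₀ = n₃`, `2 ∣ s`, tube guard `2ρ+2+ℓ₀ ≤ min n₁ n₂`): value `ω(e_C)∕2 · q^e · (ω(−1)·B(n₁), B(n₂), 0)_i` with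
  `B(n) = (if 2d + ℓ₀ + 2ρ ≤ n then q−1 else 0) − (if n + 2 = 2d + ℓ₀ + 2ρ then 1 else 0)` VERBATIM — here `B(n₂) = q − 1` (cell + parity ★ `depth_mod_two_eq_of_isElementDatum`) and
  `B(n₁) = −[s + 2 = 2d]` (`n₁ = n₃` by ★ `isoceles_of_isElementDatum`, `s ≤ 2d − 2`).
HONEST LABEL.  Count-neutral; R5b (`n₁, n₂ < 2ρ + m*`, LH7-p06 (g0)) ∕ table ∕ (β-BAL) ∕ (β) ∕ T₊ OPEN; `HC_CM` is proved only modulo the 7 printed citations (2 remaining named inputs: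
hLiu418 = `stmt-HodgeConjecture-24832`, h413 = `stmt-HodgeConjecture-24833`) until rung 0 closes.

## References
* [Kottwitz1986BaseChangeUnits] R. E. Kottwitz, *Base change for unit elements of Hecke algebras*, Compositio Math. 60 (1986), §1 pp. 240–241.
* [Rogawski1990] J. D. Rogawski, *Automorphic Representations of Unitary Groups in Three Variables*, Ann. of Math. Stud. 123 (1990), §4.9 Prop. 4.9.1 (a)(b) p. 55, §4.10 p. 58.
* [LanglandsShelstad1987] R. P. Langlands, D. Shelstad, *On the definition of transfer factors*, Math. Ann. 278 (1987), §3.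
* [Serre1979] J.-P. Serre, *Local Fields*, GTM 67 (1979), Ch. V §3 Cor. 3.
-/

set_option autoImplicit false

noncomputable section

namespace Summit.HodgeConjecture.HodgeConjecture.Cruxes.H413.F0P3cDyRamLabelledOddBoundaryG3OfSwap

open Matrix WithZero
open Literature.NumberTheory.Automorphic Literature.NumberTheory.Automorphic.HermitianLattice
open Literature.NumberTheory.Automorphic.UnitaryLatticeTree Literature.NumberTheory.Automorphic.UnitaryThreeFourFrame
open Literature.NumberTheory.LocalFields Literature.NumberTheory.LocalFields.WildQuadraticDatum
open Summit.HodgeConjecture.HodgeConjecture.Cruxes.H413.F0P3cDyRamFourFramePieces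
open Summit.HodgeConjecture.HodgeConjecture.Cruxes.H413.F0P3cDyRamFourFrameCensusDefs
open Summit.HodgeConjecture.HodgeConjecture.Cruxes.H413.F0P3cDyRamStageOneBDefs (mcOfRecord)
open Summit.HodgeConjecture.HodgeConjecture.Cruxes.H413.F0P3cDyRamDiagonalTorusDefs
open Summit.HodgeConjecture.HodgeConjecture.Cruxes.H413.F0P3cDyRamDiagonalStrataDefs
open Summit.HodgeConjecture.HodgeConjecture.Cruxes.H413.F0P3cDyRamDiagonalKappaCountDefs
open Summit.HodgeConjecture.HodgeConjecture.Cruxes.H413.F0P3cDyRamLabelledOddCountDefs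
open Summit.HodgeConjecture.HodgeConjecture.Cruxes.H413.F0P3cDyRamDiagonalKappaGluedRotations (vec3_swap01)
open Summit.HodgeConjecture.HodgeConjecture.Cruxes.H413.F0P3cDyRamElementDatumParity (isoceles_of_isElementDatum depth_mod_two_eq_of_isElementDatum)
open Summit.HodgeConjecture.HodgeConjecture.Cruxes.H413.F0P3cDyRamLabelledOddSwapEngine (finsum_stratum_shell_labelledOdd_div_relIndex_swap01_of)
open Summit.HodgeConjecture.HodgeConjecture.Cruxes.H413.F0P3cDyRamLabelledOddPureStrataG3OfRecord (finsum_stratum_G3_shell_labelledOdd_div_relIndex_eq_ofRecord)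
open scoped Valued WithZero Matrix MatrixGroups

variable {K : Type} [Field K] [Valued K ℤᵐ⁰] [CompleteSpace K] [Fintype 𝓀[K]] {σ : K →+* K} {ϖ : K} {d t : ℕ} {α β : K} {N₀ n₁ n₂ n₃ : ℕ}

/-! ## §1  The G₃ `n₂`-cell column, by the (0 1)-swap engine -/

/-- **THE `G₃` STRATUM ON THE CLEAN SHELL IN THE CELL `2ρ + m* ≤ n₂` (NO condition on `n₁`)** — the `n₁`-cell column of record at the swapped datum `(β, α; n₂, n₁, n₃)` (★ engine
`finsum_stratum_shell_labelledOdd_div_relIndex_swap01_of` with the witness `−e_C`, a token of `α − β`), slots `0 ↔ 1`, and `ω(−e_C) = ω(−1)·ω(e_C)` (★ `normSign_mul_of_dichotomy`):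
`Σᶠ_{M ∈ stratum G₃, shell} m^Λ_i(M) ∕ [𝒰 : N(S̃(M))] = [2ρ + s + ℓ₀ = n₃ ∧ 2 ∣ s ∧ 2ρ ≤ min n₁ n₂] · ω(e_C)∕2 · (ω(−1)·q^e·((q−1)·[2d ≤ s] − [s+2 = 2d]), (q−1)·q^e, 0)_i`, `e = 2ρ + s∕2 − 1`.
[cite: Kottwitz1986BaseChangeUnits, §1 pp. 240–241] [cite: Rogawski1990, §4.9 Prop. 4.9.1 (a)(b) p. 55, §4.10 p. 58] [cite: LanglandsShelstad1987, §3] [cite: Serre1979, Ch. V §3 Cor. 3] -/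
theorem finsum_stratum_G3_shell_labelledOdd_div_relIndex_eq_of_cell₂ (hD : IsRamifiedQuadraticDatum σ ϖ d t) (h2 : Valued.v (2 : K) < 1) (h2d : 2 ≤ d)
    (hE : IsElementDatum σ ϖ N₀ α β n₁ n₂ n₃) (hN₀ : d ≤ N₀) (hmc : mcOfRecord d ≤ N₀)
    (T : GL (Fin 3) K) (hT : (T : Matrix (Fin 3) (Fin 3) K) = Matrix.diagonal ![α, β, 1]) (ρ s : ℕ) (hρ : 1 ≤ ρ) (hs : 1 ≤ s)
    (hcell₂ : 2 * ρ + mstarOfRecord d ≤ n₂) {eC : K} (hσeC : σ eC = eC) (heC1 : Valued.v eC = 1)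
    (heC : Valued.v ((ϖ ^ mstarOfRecord d)⁻¹ * ((β - α) * ((ϖ * σ ϖ) ^ ((n₃ - d % 2) / 2))⁻¹ - eC * ((ϖ - σ ϖ) * ((ϖ * σ ϖ) ^ ((d - d % 2) / 2))⁻¹))) ≤ 1)
    (i : Fin 3) :
    ∑ᶠ M ∈ {M : Submodule 𝒪[K] (Fin 3 → K) | M ∈ stratum σ ϖ T ![2 * ρ + s, 2 * ρ + s, 2 * ρ] ∧
        (LatticeInLevel ϖ (d % 2) (Matrix.diagonal ![α - 1, β - 1, 0]) M ∧ ¬ LatticeInLevel ϖ (d % 2 + 1) (Matrix.diagonal ![α - 1, β - 1, 0]) M ∧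
          LatticeInLevel ϖ (mcOfRecord d) (Matrix.diagonal ![(α - 1) * (α - 1), (β - 1) * (β - 1), 0]) M)},
      (labelledOddCount σ ϖ 0 i (valueClassLabel σ ϖ (α - 1) (β - 1) (mstarOfRecord d) d) M : ℚ) /
        ((((unitStabilizer M).map (unitNormMap σ 3)).relIndex (fixedUnitTorus σ 3) : ℕ) : ℚ) =
      if 2 * ρ + s + d % 2 = n₃ ∧ 2 ∣ s ∧ 2 * ρ ≤ min n₁ n₂ then
        (normSign σ eC : ℚ) / 2 *
          (![(normSign σ (-1 : K) : ℚ) * ((Fintype.card 𝓀[K] : ℚ) ^ (2 * ρ + s / 2 - 1) * ((if 2 * d ≤ s then (Fintype.card 𝓀[K] : ℚ) - 1 else 0) - (if s + 2 = 2 * d then 1 else 0))),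
              ((Fintype.card 𝓀[K] : ℚ) - 1) * (Fintype.card 𝓀[K] : ℚ) ^ (2 * ρ + s / 2 - 1),
              (0 : ℚ)] : Fin 3 → ℚ) i
      else 0 := by
  have hD' := hD
  obtain ⟨hσ, hvσ, hϖ, hfix, -, -, -⟩ := hD'
  haveI : IsAdicComplete 𝓂[K] 𝒪[K] := isAdicComplete_valuedInteger_of_completeSpace hϖ
  obtain ⟨c, hσc, -, hc, hdich⟩ := exists_nonnorm_dichotomy_of_isRamifiedQuadraticDatum σ ϖ d t hD
  have heC0 : eC ≠ 0 := fun h => by rw [h, map_zero] at heC1; exact zero_ne_one heC1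
  -- `−e_C` is a token of `α − β` at the same exponent
  have hσeC' : σ (-eC) = -eC := by rw [map_neg, hσeC]
  have heC1' : Valued.v (-eC) = 1 := by rw [Valuation.map_neg, heC1]
  have heC' : Valued.v ((ϖ ^ mstarOfRecord d)⁻¹ * ((α - β) * ((ϖ * σ ϖ) ^ ((n₃ - d % 2) / 2))⁻¹ -
      (-eC) * ((ϖ - σ ϖ) * ((ϖ * σ ϖ) ^ ((d - d % 2) / 2))⁻¹))) ≤ 1 := by
    have e : (ϖ ^ mstarOfRecord d)⁻¹ * ((α - β) * ((ϖ * σ ϖ) ^ ((n₃ - d % 2) / 2))⁻¹ - (-eC) * ((ϖ - σ ϖ) * ((ϖ * σ ϖ) ^ ((d - d % 2) / 2))⁻¹)) =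
        -((ϖ ^ mstarOfRecord d)⁻¹ * ((β - α) * ((ϖ * σ ϖ) ^ ((n₃ - d % 2) / 2))⁻¹ - eC * ((ϖ - σ ϖ) * ((ϖ * σ ϖ) ^ ((d - d % 2) / 2))⁻¹))) := by ring
    rw [e, Valuation.map_neg]
    exact heC
  -- the engine: the n₁-cell column of record at the swapped datum, witness `w := −e_C`
  have key : ∑ᶠ M ∈ {M : Submodule 𝒪[K] (Fin 3 → K) | M ∈ stratum σ ϖ T ![2 * ρ + s, 2 * ρ + s, 2 * ρ] ∧
        (LatticeInLevel ϖ (d % 2) (Matrix.diagonal ![α - 1, β - 1, 0]) M ∧ ¬ LatticeInLevel ϖ (d % 2 + 1) (Matrix.diagonal ![α - 1, β - 1, 0]) M ∧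
          LatticeInLevel ϖ (mcOfRecord d) (Matrix.diagonal ![(α - 1) * (α - 1), (β - 1) * (β - 1), 0]) M)},
      (labelledOddCount σ ϖ 0 i (valueClassLabel σ ϖ (α - 1) (β - 1) (mstarOfRecord d) d) M : ℚ) /
        ((((unitStabilizer M).map (unitNormMap σ 3)).relIndex (fixedUnitTorus σ 3) : ℕ) : ℚ) =
      if 2 * ρ + s + d % 2 = n₃ ∧ 2 ∣ s ∧ 2 * ρ ≤ min n₂ n₁ then
        (normSign σ (-eC) : ℚ) / 2 *
          (![(normSign σ (-1 : K) : ℚ) * ((Fintype.card 𝓀[K] : ℚ) - 1) * (Fintype.card 𝓀[K] : ℚ) ^ (2 * ρ + s / 2 - 1),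
              (Fintype.card 𝓀[K] : ℚ) ^ (2 * ρ + s / 2 - 1) * ((if 2 * d ≤ s then (Fintype.card 𝓀[K] : ℚ) - 1 else 0) - (if s + 2 = 2 * d then 1 else 0)),
              (0 : ℚ)] : Fin 3 → ℚ) (Equiv.swap (0 : Fin 3) 1 i)
      else 0 :=
    finsum_stratum_shell_labelledOdd_div_relIndex_swap01_of hE hT 0 (2 * ρ + s) (2 * ρ + s) (2 * ρ) (d % 2) (d % 2 + 1) (mcOfRecord d) (mstarOfRecord d) d
      (fun α' β' n₁' (_n₂' : ℕ) n₃' (w : K) => 2 * ρ + mstarOfRecord d ≤ n₁' ∧ σ w = w ∧ Valued.v w = 1 ∧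
        Valued.v ((ϖ ^ mstarOfRecord d)⁻¹ * ((β' - α') * ((ϖ * σ ϖ) ^ ((n₃' - d % 2) / 2))⁻¹ - w * ((ϖ - σ ϖ) * ((ϖ * σ ϖ) ^ ((d - d % 2) / 2))⁻¹))) ≤ 1)
      (fun (_α' _β' : K) n₁' n₂' n₃' (w : K) (j : Fin 3) => if 2 * ρ + s + d % 2 = n₃' ∧ 2 ∣ s ∧ 2 * ρ ≤ min n₁' n₂' then
        (normSign σ w : ℚ) / 2 *
          (![(normSign σ (-1 : K) : ℚ) * ((Fintype.card 𝓀[K] : ℚ) - 1) * (Fintype.card 𝓀[K] : ℚ) ^ (2 * ρ + s / 2 - 1),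
              (Fintype.card 𝓀[K] : ℚ) ^ (2 * ρ + s / 2 - 1) * ((if 2 * d ≤ s then (Fintype.card 𝓀[K] : ℚ) - 1 else 0) - (if s + 2 = 2 * d then 1 else 0)),
              (0 : ℚ)] : Fin 3 → ℚ) j
        else 0)
      (fun T' w hE' hT' hH j => finsum_stratum_G3_shell_labelledOdd_div_relIndex_eq_ofRecord hD h2 h2d hE' hN₀ hmc T' hT' ρ s hρ hs hH.1 hH.2.1 hH.2.2.1 hH.2.2.2 j)
      (-eC) ⟨hcell₂, hσeC', heC1', heC'⟩ i
  rw [key, min_comm n₂ n₁]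
  -- `ω(−e_C) = ω(−1)·ω(e_C)`, `ω(−1)² = 1`
  have hneg : normSign σ (-eC) = normSign σ (-1 : K) * normSign σ eC := by
    rw [show (-eC : K) = -1 * eC by ring]
    exact F0P3cDyRamDiagonalKappaCountEval.normSign_mul_of_dichotomy σ hσc hc hdich (by rw [map_neg, map_one]) hσeC (by norm_num) heC0
  have hωm : (normSign σ (-1 : K) : ℚ) * (normSign σ (-1 : K) : ℚ) = 1 := by
    unfold normSign; split_ifs <;> norm_num
  by_cases hg : 2 * ρ + s + d % 2 = n₃ ∧ 2 ∣ s ∧ 2 * ρ ≤ min n₁ n₂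
  · rw [if_pos hg, if_pos hg, hneg, vec3_swap01]
    push_cast
    fin_cases i
    · simp only [Fin.zero_eta, Matrix.cons_val_zero]
      ring
    · simp only [Fin.mk_one, Matrix.cons_val_one, Matrix.cons_val_zero]
      linear_combination ((normSign σ eC : ℚ) / 2 * (((Fintype.card 𝓀[K] : ℚ) - 1) * (Fintype.card 𝓀[K] : ℚ) ^ (2 * ρ + s / 2 - 1))) * hωm
    · simp only [Fin.reduceFinMk, Matrix.cons_val_two, Matrix.tail_cons, Matrix.head_cons, mul_zero]
  · rw [if_neg hg, if_neg hg]

/-! ## §2  R5a in the bracket currency of ★ (T1) p861261 `hG3t` ∕ ★ p861354 `hbeyond`, on `n₁ < 2ρ + m* ≤ n₂` -/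

/-- **R5a — THE CAPPED TUBE CLASSES OF TOWER 3 BEYOND THE CELL IN SLOT `0` AND INSIDE IT IN SLOT `1`** (`n₁ < 2ρ + m* ≤ n₂`; read `2ρ + s + ℓ₀ = n₃`, `2 ∣ s`, tube guard
`2ρ + 2 + ℓ₀ ≤ min n₁ n₂`; token `e_C` of `β − α`; `2 ≤ d ≤ N₀`, `mcOfRecord d ≤ N₀`, `|2| < 1`), in the bracket currency of `hG3t` VERBATIM:
`Σᶠ_{M ∈ stratum G₃, shell} m^Λ_i(M) ∕ [𝒰 : N(S̃(M))] = ω(e_C)∕2 · q^{2ρ+s∕2−1} · (ω(−1)·B(n₁), B(n₂), 0)_i`, `B(n) = (q−1)·[2d+ℓ₀+2ρ ≤ n] − [n+2 = 2d+ℓ₀+2ρ]` — §1 with `B(n₂) = q−1`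
(cell + parity ★ `depth_mod_two_eq_of_isElementDatum`) and `B(n₁) = −[s+2 = 2d]` (`n₁ = n₃` by ★ `isoceles_of_isElementDatum`; `s ≤ 2d−2`).  The other half of the `hbeyond`
binder of ★ p861354 (`n₁, n₂ < 2ρ + m*`) is LH7-p06 (g0)'s R5b. [cite: Kottwitz1986BaseChangeUnits, §1 pp. 240–241] [cite: Rogawski1990, §4.9 Prop. 4.9.1 (a)(b) p. 55, §4.10 p. 58]
[cite: LanglandsShelstad1987, §3] -/
theorem finsum_stratum_G3_shell_labelledOdd_div_relIndex_beyond_of_cell₂ (hD : IsRamifiedQuadraticDatum σ ϖ d t) (h2 : Valued.v (2 : K) < 1) (h2d : 2 ≤ d)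
    (hE : IsElementDatum σ ϖ N₀ α β n₁ n₂ n₃) (hN₀ : d ≤ N₀) (hmc : mcOfRecord d ≤ N₀)
    (T : GL (Fin 3) K) (hT : (T : Matrix (Fin 3) (Fin 3) K) = Matrix.diagonal ![α, β, 1]) (ρ s : ℕ) (hρ : 1 ≤ ρ)
    (hlt : n₁ < 2 * ρ + mstarOfRecord d) (hcell₂ : 2 * ρ + mstarOfRecord d ≤ n₂)
    (hP : 2 * ρ + s + d % 2 = n₃) (h2s : 2 ∣ s) (hcap : 2 * ρ + 2 + d % 2 ≤ min n₁ n₂)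
    {eC : K} (hσeC : σ eC = eC) (heC1 : Valued.v eC = 1)
    (heC : Valued.v ((ϖ ^ mstarOfRecord d)⁻¹ * ((β - α) * ((ϖ * σ ϖ) ^ ((n₃ - d % 2) / 2))⁻¹ - eC * ((ϖ - σ ϖ) * ((ϖ * σ ϖ) ^ ((d - d % 2) / 2))⁻¹))) ≤ 1)
    (i : Fin 3) :
    ∑ᶠ M ∈ {M : Submodule 𝒪[K] (Fin 3 → K) | M ∈ stratum σ ϖ T ![2 * ρ + s, 2 * ρ + s, 2 * ρ] ∧
        (LatticeInLevel ϖ (d % 2) (Matrix.diagonal ![α - 1, β - 1, 0]) M ∧ ¬ LatticeInLevel ϖ (d % 2 + 1) (Matrix.diagonal ![α - 1, β - 1, 0]) M ∧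
          LatticeInLevel ϖ (mcOfRecord d) (Matrix.diagonal ![(α - 1) * (α - 1), (β - 1) * (β - 1), 0]) M)},
      (labelledOddCount σ ϖ 0 i (valueClassLabel σ ϖ (α - 1) (β - 1) (mstarOfRecord d) d) M : ℚ) /
        ((((unitStabilizer M).map (unitNormMap σ 3)).relIndex (fixedUnitTorus σ 3) : ℕ) : ℚ) =
      (normSign σ eC : ℚ) / 2 * (Fintype.card 𝓀[K] : ℚ) ^ (2 * ρ + s / 2 - 1) *
        (![(normSign σ (-1 : K) : ℚ) * ((if 2 * d + d % 2 + 2 * ρ ≤ n₁ then (Fintype.card 𝓀[K] : ℚ) - 1 else 0) - (if n₁ + 2 = 2 * d + d % 2 + 2 * ρ then 1 else 0)),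
            ((if 2 * d + d % 2 + 2 * ρ ≤ n₂ then (Fintype.card 𝓀[K] : ℚ) - 1 else 0) - (if n₂ + 2 = 2 * d + d % 2 + 2 * ρ then 1 else 0)),
            (0 : ℚ)] : Fin 3 → ℚ) i := by
  have hiso := isoceles_of_isElementDatum hD hE
  obtain ⟨hp1, hp2, -⟩ := depth_mod_two_eq_of_isElementDatum hD hE hN₀
  have hmsv : mstarOfRecord d = d % 2 + 2 * d - 1 := rfl
  have hlt' := hlt
  have hcell' := hcell₂
  rw [hmsv] at hlt' hcell'
  have hc1 : 2 * ρ + 2 + d % 2 ≤ n₁ := hcap.trans (min_le_left _ _)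
  have hc2 : 2 * ρ + 2 + d % 2 ≤ n₂ := hcap.trans (min_le_right _ _)
  -- `n₁ = n₃` (isosceles; `n₁ < n₂`), so `s = n₁ − 2ρ − ℓ₀ ∈ [2, 2d−2]`
  have hn13 : n₁ = n₃ := by
    rcases hiso with ⟨h1, -⟩ | ⟨h1, -⟩ | ⟨-, h2⟩
    · omega
    · exact h1
    · omega
  have hs : 1 ≤ s := by omega
  rw [finsum_stratum_G3_shell_labelledOdd_div_relIndex_eq_of_cell₂ hD h2 h2d hE hN₀ hmc T hT ρ s hρ hs hcell₂ hσeC heC1 heC i,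
    if_pos ⟨hP, h2s, le_trans (by omega) hcap⟩]
  have hA₁ : ¬ (2 * d + d % 2 + 2 * ρ ≤ n₁) := by omega
  have hA₂ : ¬ (2 * d ≤ s) := by omega
  have hB₁ : 2 * d + d % 2 + 2 * ρ ≤ n₂ := by omega
  have hB₂ : ¬ (n₂ + 2 = 2 * d + d % 2 + 2 * ρ) := by omega
  rw [if_neg hA₁, if_neg hA₂, if_pos hB₁, if_neg hB₂]
  by_cases hb : s + 2 = 2 * d
  · rw [if_pos hb, if_pos (show n₁ + 2 = 2 * d + d % 2 + 2 * ρ by omega)]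
    fin_cases i
    · simp only [Fin.zero_eta, Matrix.cons_val_zero]
      ring
    · simp only [Fin.mk_one, Matrix.cons_val_one, Matrix.cons_val_zero]
      ring
    · simp only [Fin.reduceFinMk, Matrix.cons_val_two, Matrix.tail_cons, Matrix.head_cons, mul_zero]
  · rw [if_neg hb, if_neg (show ¬ (n₁ + 2 = 2 * d + d % 2 + 2 * ρ) by omega)]
    fin_cases i
    · simp only [Fin.zero_eta, Matrix.cons_val_zero]
      ring
    · simp only [Fin.mk_one, Matrix.cons_val_one, Matrix.cons_val_zero]
      ring
    · simp only [Fin.reduceFinMk, Matrix.cons_val_two, Matrix.tail_cons, Matrix.head_cons, mul_zero]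

end Summit.HodgeConjecture.HodgeConjecture.Cruxes.H413.F0P3cDyRamLabelledOddBoundaryG3OfSwap

end
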